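import Mathlib.RingTheory.MvPowerSeries.LinearTopology
import Mathlib.RingTheory.PowerSeries.PiTopology
import Mathlib.RingTheory.PowerSeries.Evaluation
import Literature.NumberTheory.EllipticCurves.PadicSeriesEvaluation
import HarnessLib

/-!
# Route `ByReductionTypeAtTwo` (rung K4), crux `SupersingularRankZeroAtTwo` (item stmt-BirchSwinnertonDyer-19097):
# the translation automorphisms `T ↦ T + t` (`‖t‖ < 1`) of the Iwasawa algebra `Λ = ℤ_p⟦T⟧`
# (seat `bsd-2adic-ss-1`, GEN 17 — brick [A] of K67-EC `FlatBlindEulerCharAtTwo` of the alternative line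
# `Cruxes/SupersingularRankZeroAtTwo/Lines/odd_blind_package.lean`)

HONEST FRAMING (cell `bsd-2adic`, run/shared/lean/pub/bsd-2adic/): THEOREMS (and two plumbing
definitions with bodies) ONLY — pure commutative algebra over `ℤ_p⟦T⟧`; no named fact, no `sorry`, no
instance declared (the product-topology instances are Mathlib's scoped ones, opened locally); nothing
about any curve, Selmer group or `L`-function; nothing booked; BSD is not proved by any of this.
PARTITION (D-0054): X5@2 good-ss r₀ block × p = 2 — types-the-object-of (the Λ-algebra of the twist by
the order-2 character); closes none. bears_on: K4 (route-BirchSwinnertonDyer-ByReductionTypeAtTwo item 19097).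

## What and why

For `t ∈ ℤ_p` with `‖t‖ < 1` the substitution `f(T) ↦ f(T + t)` is a continuous `ℤ_p`-algebra
automorphism `τ_t` of `Λ = ℤ_p⟦T⟧` (inverse `τ_{-t}`), with `τ_t(T) = T + t` and constant term
`τ_t(f)(0) = f(t) = Σ_d f_d t^d` — the value of `f` at the point `t` of the open unit disc, i.e. the
tree's `BlindLever.evalAt t f` (`Rank1Residual/Supersingular/BlindPointLever.lean`, same `tsum`).

USE (K67-EC of `odd_blind_package`, = Greenberg LNM 1716 Lemma 4.2 at the element `T + 2`): in
Iwasawa theory `Λ = ℤ_p⟦Γ⟧` with `T = γ - 1`; restricting the scalars of a `Λ`-module `X` along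
`τ_2` makes `T` act as `T + 2 = γ + 1`, so the tree's dual-pair Lemma 4.2
(`IwasawaDual.IsDualPair.constantCoeff_charGenerator_mul_natCard_endCoinvariants`,
`Literature/…/IwasawaEulerCharRankZeroProofs.lean`, ANY dual pair `T ↔ ψ`) applies to the pair
(`X` twisted by `τ_2`, `Sel` with `ψ = conj_γ + 1`) — local nilpotence of `(2, ψ + 2)` holds BECAUSE
`p = 2` — and reads the characteristic series of the twisted module at `T = 0` as `f(−2)`
(`constantCoeff_translate` with `t = -2`): the "blind point" of the `2`-adic theory
(Mazur–Tate–Teitelbaum §I.14). The twist proper by the order-2 character `ψ₂ : γ ↦ -1` is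
`T ↦ -T - 2 = τ_{-2} ∘ (T ↦ -T)`; for K67-EC the translation suffices. Remaining bricks (NOT here):
[B] `charIdeal` under restriction of scalars along `τ_t`; [C] the twisted `IsDualPair`; [D] the application.

Construction: Mathlib's topological evaluation of power series (`PowerSeries.aeval`; Bourbaki,
*Algèbre* IV §4 no. 3) INTO `Λ` itself, `Λ` carrying the product topology of the `p`-adic topology
(`PowerSeries.WithPiTopology`; complete, Hausdorff, linearly topologized since `ℤ_p` is —
`Literature.NumberTheory.EllipticCurves.padicInt_isLinearTopology`), at the topologically nilpotent
element `X + C t`. (Mathlib's algebraic `PowerSeries.subst` does NOT apply: it requires a NILPOTENT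
constant coefficient, and `t ≠ 0` is not nilpotent in `ℤ_p`.)

## Main statements

* `hasEval_X_add_C` — `X + C t` is evaluable (topologically nilpotent) for `‖t‖ < 1`;
* `translate ht : Λ →ₐ[ℤ_p] Λ`, `translate_X`, `translate_C`, `continuous_translate`,
  `hasSum_translate` (`τ_t f = Σ_d f_d (T + t)^d`);
* `algHom_eq_of_continuous_of_apply_X_eq` — a continuous `ℤ_p`-algebra endomorphism of `Λ` is
  determined by the image of `T`;
* `translate_translate` (`τ_s ∘ τ_t = τ_{t+s}`), `translate_zero`, `translate_neg_translate`,
  `translateEquiv ht : Λ ≃ₐ[ℤ_p] Λ`;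
* `constantCoeff_translate` — **`(τ_t f)(0) = Σ' d, f_d t^d`** (the value at `t`).

## References

* N. Bourbaki, *Algèbre*, Ch. IV §4 no. 3 (substitution in formal power series) — the Mathlib API used.
* B. Mazur, J. Tate, J. Teitelbaum, Invent. Math. 84 (1986), §I.14 (the point `T = -2`).
  [cite: MazurTateTeitelbaum1986Invent, §I.14]
* R. Greenberg, *Iwasawa theory for elliptic curves*, LNM 1716 (1999), §4 Lemma 4.2.
  [cite: GreenbergLNM1716, §4 Lemma 4.2]
* L. Washington, *Introduction to Cyclotomic Fields*, GTM 83, §7.1 (`Λ = ℤ_p⟦T⟧`).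
  [cite: Washington1997, §7.1]
-/

set_option autoImplicit false

noncomputable section

open scoped MvPowerSeries.WithPiTopology PowerSeries.WithPiTopology
open PowerSeries Filter Topology

-- the Theorems namespace of this sub repeats the summit name by design (D-0017 nested layout)
set_option linter.dupNamespace false

namespace Summit.BirchSwinnertonDyer.BirchSwinnertonDyer.Theorems

namespace IwasawaTranslation

variable {p : ℕ} [Fact p.Prime]

/-! ### Evaluability of `X + C t` -/

/-- For `‖t‖ < 1`, the power series `X + C t ∈ ℤ_p⟦X⟧` is topologically nilpotent for the product
topology (its constant coefficient `t` is topologically nilpotent in `ℤ_p`), i.e. `PowerSeries.HasEval`.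
[folklore] -/
theorem hasEval_X_add_C {t : ℤ_[p]} (ht : ‖t‖ < 1) :
    PowerSeries.HasEval (PowerSeries.X + PowerSeries.C t : PowerSeries ℤ_[p]) := by
  rw [PowerSeries.hasEval_def]
  refine MvPowerSeries.LinearTopology.isTopologicallyNilpotent_of_constantCoeff ?_
  have hc : MvPowerSeries.constantCoeff (PowerSeries.X + PowerSeries.C t : PowerSeries ℤ_[p]) = t := by
    change PowerSeries.constantCoeff (PowerSeries.X + PowerSeries.C t) = t
    rw [map_add, PowerSeries.constantCoeff_X, PowerSeries.constantCoeff_C, zero_add]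
  rw [hc]
  exact Literature.NumberTheory.EllipticCurves.padicInt_tendsto_pow_of_norm_lt_one ht

/-! ### The translation `τ_t` -/

/-- **The translation `τ_t : ℤ_p⟦T⟧ → ℤ_p⟦T⟧`, `f(T) ↦ f(T + t)`** (`‖t‖ < 1`), as a `ℤ_p`-algebra
homomorphism: Mathlib's topological evaluation `PowerSeries.aeval` at the point `X + C t` of `ℤ_p⟦T⟧`
(product topology). [folklore] -/
def translate {t : ℤ_[p]} (ht : ‖t‖ < 1) : PowerSeries ℤ_[p] →ₐ[ℤ_[p]] PowerSeries ℤ_[p] :=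
  PowerSeries.aeval (hasEval_X_add_C ht)

/-- `τ_t(T) = T + t`. [folklore] -/
theorem translate_X {t : ℤ_[p]} (ht : ‖t‖ < 1) :
    translate ht PowerSeries.X = PowerSeries.X + PowerSeries.C t := by
  have h := PowerSeries.aeval_coe (hasEval_X_add_C ht) (Polynomial.X : Polynomial ℤ_[p])
  rw [Polynomial.coe_X, Polynomial.aeval_X] at h
  exact h

/-- `τ_t` fixes constants: `τ_t(C c) = C c`. [folklore] -/
theorem translate_C {t : ℤ_[p]} (ht : ‖t‖ < 1) (c : ℤ_[p]) :
    translate ht (PowerSeries.C c) = PowerSeries.C c := by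
  have h := PowerSeries.aeval_coe (hasEval_X_add_C ht) (Polynomial.C c : Polynomial ℤ_[p])
  rw [Polynomial.coe_C, Polynomial.aeval_C] at h
  rw [translate, h]
  rfl

/-- `τ_t` is continuous for the product topology. [folklore] -/
theorem continuous_translate {t : ℤ_[p]} (ht : ‖t‖ < 1) : Continuous (translate ht) :=
  PowerSeries.continuous_aeval (hasEval_X_add_C ht)

/-- `τ_t f = Σ_d f_d · (T + t)^d` (convergent sum in the product topology). [folklore] -/
theorem hasSum_translate {t : ℤ_[p]} (ht : ‖t‖ < 1) (f : PowerSeries ℤ_[p]) :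
    HasSum (fun d : ℕ ↦ PowerSeries.coeff d f • (PowerSeries.X + PowerSeries.C t) ^ d)
      (translate ht f) :=
  PowerSeries.hasSum_aeval (hasEval_X_add_C ht) f

/-- `translate` does not depend on the proof of `‖t‖ < 1`, and equal points give equal translations.
[folklore] -/
theorem translate_congr {t s : ℤ_[p]} (ht : ‖t‖ < 1) (hs : ‖s‖ < 1) (h : t = s) :
    translate ht = translate hs := by
  subst h
  rfl

/-! ### Uniqueness and the group law `τ_s ∘ τ_t = τ_{t+s}` -/

/-- **A continuous `ℤ_p`-algebra endomorphism of `ℤ_p⟦T⟧` is determined by the image of `T`**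
(Mathlib's `PowerSeries.aeval_unique`: every continuous algebra map is the evaluation at the image
of `X`). [folklore] -/
theorem algHom_eq_of_continuous_of_apply_X_eq
    {ε ε' : PowerSeries ℤ_[p] →ₐ[ℤ_[p]] PowerSeries ℤ_[p]} (hε : Continuous ε) (hε' : Continuous ε')
    (h : ε PowerSeries.X = ε' PowerSeries.X) : ε = ε' := by
  have key : ∀ {a a' : PowerSeries ℤ_[p]} (ha : PowerSeries.HasEval a) (ha' : PowerSeries.HasEval a'),
      a = a' → (PowerSeries.aeval (R := ℤ_[p]) ha : PowerSeries ℤ_[p] →ₐ[ℤ_[p]] PowerSeries ℤ_[p]) =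
        PowerSeries.aeval (R := ℤ_[p]) ha' := by
    rintro a a' ha ha' rfl
    rfl
  rw [← PowerSeries.aeval_unique hε, ← PowerSeries.aeval_unique hε']
  exact key _ _ h

/-- The sum of two points of the open unit disc lies in it (ultrametric inequality). [folklore] -/
theorem norm_add_lt_one {t s : ℤ_[p]} (ht : ‖t‖ < 1) (hs : ‖s‖ < 1) : ‖t + s‖ < 1 :=
  (PadicInt.nonarchimedean t s).trans_lt (max_lt ht hs)

/-- **Group law: `τ_s (τ_t f) = τ_{t+s} f`.** [folklore] -/
theorem translate_translate {t s : ℤ_[p]} (ht : ‖t‖ < 1) (hs : ‖s‖ < 1) (f : PowerSeries ℤ_[p]) :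
    translate hs (translate ht f) = translate (norm_add_lt_one ht hs) f := by
  have hcomp : (translate hs).comp (translate ht) = translate (norm_add_lt_one ht hs) := by
    refine algHom_eq_of_continuous_of_apply_X_eq
      ((continuous_translate hs).comp (continuous_translate ht)) (continuous_translate _) ?_
    rw [AlgHom.comp_apply, translate_X, map_add, translate_X, translate_C, translate_X, map_add,
      add_assoc, add_comm (PowerSeries.C s) (PowerSeries.C t)]
  exact congrArg (fun φ : PowerSeries ℤ_[p] →ₐ[ℤ_[p]] PowerSeries ℤ_[p] ↦ φ f) hcomp

/-- `τ_0 = id`. [folklore] -/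
theorem translate_zero (f : PowerSeries ℤ_[p]) :
    translate (t := (0 : ℤ_[p])) (by rw [norm_zero]; exact zero_lt_one) f = f := by
  have hid : translate (t := (0 : ℤ_[p])) (by rw [norm_zero]; exact zero_lt_one) =
      AlgHom.id ℤ_[p] (PowerSeries ℤ_[p]) := by
    refine algHom_eq_of_continuous_of_apply_X_eq (continuous_translate _) continuous_id ?_
    rw [translate_X, map_zero, add_zero, AlgHom.id_apply]
  rw [hid, AlgHom.id_apply]

/-- The negative of a point of the open unit disc lies in it. [folklore] -/
theorem norm_neg_lt_one {t : ℤ_[p]} (ht : ‖t‖ < 1) : ‖-t‖ < 1 := by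
  rwa [norm_neg]

/-- **`τ_{-t}` is a left inverse of `τ_t`.** [folklore] -/
theorem translate_neg_translate {t : ℤ_[p]} (ht : ‖t‖ < 1) (f : PowerSeries ℤ_[p]) :
    translate (norm_neg_lt_one ht) (translate ht f) = f := by
  rw [translate_translate ht (norm_neg_lt_one ht) f,
    translate_congr (norm_add_lt_one ht (norm_neg_lt_one ht)) (by rw [norm_zero]; exact zero_lt_one)
      (add_neg_cancel t), translate_zero]

/-- **`τ_{-t}` is a right inverse of `τ_t`.** [folklore] -/
theorem translate_translate_neg {t : ℤ_[p]} (ht : ‖t‖ < 1) (f : PowerSeries ℤ_[p]) :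
    translate ht (translate (norm_neg_lt_one ht) f) = f := by
  rw [translate_translate (norm_neg_lt_one ht) ht f,
    translate_congr (norm_add_lt_one (norm_neg_lt_one ht) ht) (by rw [norm_zero]; exact zero_lt_one)
      (neg_add_cancel t), translate_zero]

/-- **The translation AUTOMORPHISM `τ_t : ℤ_p⟦T⟧ ≃ₐ[ℤ_p] ℤ_p⟦T⟧`** with inverse `τ_{-t}`.
[folklore] -/
def translateEquiv {t : ℤ_[p]} (ht : ‖t‖ < 1) : PowerSeries ℤ_[p] ≃ₐ[ℤ_[p]] PowerSeries ℤ_[p] :=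
  AlgEquiv.ofAlgHom (translate ht) (translate (norm_neg_lt_one ht))
    (by ext f : 1; exact translate_translate_neg ht f)
    (by ext f : 1; exact translate_neg_translate ht f)

/-- `translateEquiv` is `translate` (unfolding). [folklore] -/
@[simp]
theorem translateEquiv_apply {t : ℤ_[p]} (ht : ‖t‖ < 1) (f : PowerSeries ℤ_[p]) :
    translateEquiv ht f = translate ht f :=
  rfl

/-- The inverse of `translateEquiv ht` is translation by `-t` (unfolding). [folklore] -/
@[simp]
theorem translateEquiv_symm_apply {t : ℤ_[p]} (ht : ‖t‖ < 1) (f : PowerSeries ℤ_[p]) :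
    (translateEquiv ht).symm f = translate (norm_neg_lt_one ht) f :=
  rfl

/-! ### The constant term of `τ_t f` is the value `f(t)` -/

/-- **`(τ_t f)(0) = f(t) = Σ' d, f_d t^d`**: the constant coefficient of the translate is the value of
`f` at the point `t` of the open unit disc (the constant coefficient is continuous for the product
topology and `(T + t)^d` has constant term `t^d`). [folklore] -/
theorem constantCoeff_translate {t : ℤ_[p]} (ht : ‖t‖ < 1) (f : PowerSeries ℤ_[p]) :
    PowerSeries.constantCoeff (translate ht f) = ∑' d : ℕ, PowerSeries.coeff d f * t ^ d := by
  have hsum := (hasSum_translate ht f).map (PowerSeries.constantCoeff (R := ℤ_[p]))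
    (PowerSeries.WithPiTopology.continuous_constantCoeff ℤ_[p])
  have hfun : ((PowerSeries.constantCoeff (R := ℤ_[p])) ∘
      fun d : ℕ ↦ PowerSeries.coeff d f • (PowerSeries.X + PowerSeries.C t) ^ d) =
      fun d : ℕ ↦ PowerSeries.coeff d f * t ^ d := by
    funext d
    rw [Function.comp_apply, PowerSeries.constantCoeff_smul, map_pow, map_add,
      PowerSeries.constantCoeff_X, PowerSeries.constantCoeff_C, zero_add, smul_eq_mul]
  rw [hfun] at hsum
  exact hsum.tsum_eq.symm

/-- In particular `(τ_t f)(0) = 0` detects the zero of `f` at `t`: `f(t) = 0 ↔ (τ_t f)(0) = 0`.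
[folklore] -/
theorem constantCoeff_translate_eq_zero_iff {t : ℤ_[p]} (ht : ‖t‖ < 1) (f : PowerSeries ℤ_[p]) :
    PowerSeries.constantCoeff (translate ht f) = 0 ↔ ∑' d : ℕ, PowerSeries.coeff d f * t ^ d = 0 := by
  rw [constantCoeff_translate]

end IwasawaTranslation

end Summit.BirchSwinnertonDyer.BirchSwinnertonDyer.Theorems

end
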